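import Summits.BirchSwinnertonDyer.BirchSwinnertonDyer.Theorems.KolyvaginRoadThreeSchneiderTamAtThreeHeightLogNumeratorExactPScale
import HarnessLib

/-!
# «The height is the logarithm of the numerator» — the EXACT second-order law at EVERY multiplicative
# prime `p ≥ 5`, part 5: rational proxies for `κ_E` and the truncated logarithm (generic `p`)

HONEST FRAMING (cell `bsd-stepL`, seat `bsd-stepL-tam3-p2` g5, WIDTH-LEVER second lane «closed-form Schneider
local factor … by Kodaira type (finite case table proved once)»; `--supports stmt-BirchSwinnertonDyer-19154 --as helper`):
THEOREMS ONLY, unconditional, route-independent (no Theses import); 0 definitions, 0 named facts, 0 sorry;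
nothing here proves the crux `SchneiderTamAtThree`, Schneider's conjecture or BSD. The two ingredients that turn
the exact law of part 4 (`κ_E = (C⁻²E₂(q) − b₂)/12`, a transcendental-looking constant) into a ONE-congruence row
checker (part 6): `p`-generic twins of part 7c (`…ExactLaws` §19, g3, `p = 3`) and a truncated Iwasawa logarithm.

* §13 `norm_tateS_sub_self_le_padic` (`‖s_k(q) − q‖ ≤ ‖q‖²`), `norm_inv_uniformisationScaleSq_add_linear_le_padic`
  (`‖C⁻² + (c₆/c₄)(1 + 744q)‖ ≤ ‖q‖²`: `E₄ = 1 + 240s₃`, `E₆ = 1 − 504s₅`, `s_k ≡ q (mod q²)`);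
* §14 `norm_kappaE_add_kappa₀_le_padic` — **`κ_E ≡ −κ₀' (mod q)`**, `κ₀' = (b₂b₄ − 18b₆)/c₄`;
  `norm_kappaE_add_kappa₀_add_linear_le_padic` — **`κ_E ≡ −κ₀' − 60(c₆/c₄)q (mod q²)`**;
  `norm_kappaE_add_kappa₀_add_j_le_padic` — the same with `q ↦ 1/j` (`‖1/j − q‖ ≤ ‖q‖²`), i.e. for THE Tate parameter
  `κ_E ≡ −[(b₂b₄ − 18b₆)c₄³ + 60c₆Δ]/c₄⁴ (mod p^{2ν})` — a RATIONAL number of the minimal model;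
* §15 `norm_padicLog_one_add_sub_sum_le_padic`
  (`‖log_p(1+u) − Σ_{n<N} (−1)ⁿuⁿ⁺¹/(n+1)‖ ≤ (N+1)‖u‖^{N+1}` on `‖u‖ ≤ p⁻¹`) and `norm_padicLog_intCast_sub_trunc_le_padic`
  (`log_p a = (p−1)⁻¹·[A − A²/2 + ⋯ ± A^N/N] + O((N+1)‖A‖^{N+1})`, `A = a^{p−1} − 1`, `p ∤ a`).

References: [SilvermanATAEC1994] V.1 (1.1), Thm. V.3.1, Lemma V.5.1; [SteinWuthrich2013] §4.2; [Iwasawa1972PadicL] §4.4;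
tree: g3 `…ExactLaws`, g4 `…SplitDigit` (`norm_inv_uniformisationScaleSq_add_le`, `norm_padicLog_intCast_add_le`),
lane A `…RegCertKernelO2Log` (`norm_tateS_sub_self_le` at `p = 3`).
-/

noncomputable section

open scoped Classical Nat
open scoped ArithmeticFunction.sigma
open Filter Topology IsUltrametricDist
open WeierstrassCurve Literature.NumberTheory.EllipticCurves
open Literature.NumberTheory.EllipticCurves.SteinWuthrich2013
open Literature.NumberTheory.EllipticCurves.TateCurve
open Literature.NumberTheory.EllipticCurves.Rank1Residual
open Summit.BirchSwinnertonDyer.Uniform.UI.O2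

namespace Summit.BirchSwinnertonDyer.Rank1Residual.X11b.RegMult.HeightLogNumerator

variable {p : ℕ} [hp : Fact p.Prime]

/-! ### §13 `s_k(q) ≡ q (mod q²)` and the scale to second order -/

section QSeries

/-- **`‖s_k(q) − q‖_p ≤ ‖q‖_p²`** for `‖q‖_p < 1` (`s_k(q) = q + Σ_{n≥2} σ_k(n)qⁿ`; lane A's `p = 3` lemma verbatim).
[cite: SilvermanATAEC1994, Ch. V §1 (1.1)(b)] -/
theorem norm_tateS_sub_self_le_padic (k : ℕ) {q : ℚ_[p]} (hq : ‖q‖ < 1) : ‖tateS k q - q‖ ≤ ‖q‖ ^ 2 := by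
  have hsum := TateCurve.summable_tateS_term k hq
  have hsplit := hsum.sum_add_tsum_nat_add 1
  have hone : ∑ i ∈ Finset.range 1, ((σ k (i + 1) : ℕ) : ℚ_[p]) * q ^ (i + 1) = q := by
    simp [ArithmeticFunction.sigma_one]
  have hdef : tateS k q = ∑' n : ℕ, ((σ k (n + 1) : ℕ) : ℚ_[p]) * q ^ (n + 1) := by rw [tateS]
  rw [hdef, ← hsplit, hone, add_sub_cancel_left]
  refine IsUltrametricDist.norm_tsum_le_of_forall_le_of_nonneg (sq_nonneg _) fun n ↦ ?_
  rw [norm_mul, norm_pow]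
  calc ‖((σ k (n + 1 + 1) : ℕ) : ℚ_[p])‖ * ‖q‖ ^ (n + 1 + 1) ≤ 1 * ‖q‖ ^ (n + 1 + 1) := by
        gcongr; exact norm_natCast_le_one (p := p) _
    _ = ‖q‖ ^ 2 * ‖q‖ ^ n := by ring
    _ ≤ ‖q‖ ^ 2 * 1 := by gcongr; exact pow_le_one₀ (norm_nonneg _) hq.le
    _ = ‖q‖ ^ 2 := mul_one _

variable {W : WeierstrassCurve ℚ}

/-- **`‖C⁻² + (c₆/c₄)(1 + 744q)‖_p ≤ ‖q‖_p²`**: the inverse squared uniformisation scale to SECOND order in `q`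
(`C⁻² = −(c₆/c₄)E₄(q)/E₆(q)`, `E₄ = 1 + 240s₃`, `E₆ = 1 − 504s₅`, `s₃, s₅ ≡ q (mod q²)`, `240 + 504 = 744`), at a
multiplicative prime, ANY `‖q‖ < 1`. (`p = 3`: part 6a of the chain, with the extra factor `3⁻¹`.)
[cite: SilvermanATAEC1994, Ch. V §1 (1.1), Thm. V.3.1] [cite: SteinWuthrich2013, §4.2] -/
theorem norm_inv_uniformisationScaleSq_add_linear_le_padic [W.IsElliptic] [W.IsGloballyMinimal] (hW : Mult W p)
    {q : ℚ_[p]} (hq : ‖q‖ < 1) :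
    ‖(uniformisationScaleSq W p q)⁻¹ + (W.c₆ : ℚ_[p]) / (W.c₄ : ℚ_[p]) * (1 + 744 * q)‖ ≤ ‖q‖ ^ 2 := by
  have h4 : ‖(W.c₄ : ℚ_[p])‖ = 1 := norm_c₄_eq_one_of_hasMultiplicativeReductionAtPrime hW
  have h6 : ‖(W.c₆ : ℚ_[p])‖ = 1 := norm_c₆_eq_one_of_mult hW
  have hc₄ : (W.baseChange ℚ_[p]).c₄ = (W.c₄ : ℚ_[p]) := (map_c₄ W (algebraMap ℚ ℚ_[p])).trans (eq_ratCast _ _)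
  have hc₆ : (W.baseChange ℚ_[p]).c₆ = (W.c₆ : ℚ_[p]) := (map_c₆ W (algebraMap ℚ ℚ_[p])).trans (eq_ratCast _ _)
  have h12 : (12 : ℚ_[p]) ≠ 0 := by norm_num
  have hs3 : ‖tateS 3 q - q‖ ≤ ‖q‖ ^ 2 := norm_tateS_sub_self_le_padic 3 hq
  have hs5 : ‖tateS 5 q - q‖ ≤ ‖q‖ ^ 2 := norm_tateS_sub_self_le_padic 5 hq
  have hs5n : ‖tateS 5 q‖ ≤ ‖q‖ := norm_tateS_le hq.le
  have hE6n : ‖tateE6 q‖ = 1 := norm_tateE6_eq_one hq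
  have hE60 : tateE6 q ≠ 0 := norm_pos_iff.mp (by rw [hE6n]; exact one_pos)
  have hc40 : (W.c₄ : ℚ_[p]) ≠ 0 := norm_pos_iff.mp (by rw [h4]; exact one_pos)
  have hc60 : (W.c₆ : ℚ_[p]) ≠ 0 := norm_pos_iff.mp (by rw [h6]; exact one_pos)
  have hint : ∀ z : ℤ, ‖((z : ℚ_[p]))‖ ≤ 1 := fun z ↦ Padic.norm_int_le_one z
  unfold uniformisationScaleSq
  rw [tateCurve_c₄, tateCurve_c₆ h12, hc₄, hc₆, tateE4_eq]
  have hE6def : tateE6 q = 1 - 504 * tateS 5 q := rfl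
  have e : (-tateE6 q * (W.c₄ : ℚ_[p]) / ((1 + 240 * tateS 3 q) * (W.c₆ : ℚ_[p])))⁻¹ +
      (W.c₆ : ℚ_[p]) / (W.c₄ : ℚ_[p]) * (1 + 744 * q) =
      ((W.c₆ : ℚ_[p]) / (W.c₄ : ℚ_[p])) *
        (-(240 * (tateS 3 q - q)) - 504 * (tateS 5 q - q) - 374976 * (q * tateS 5 q)) / tateE6 q := by
    rw [hE6def]
    rw [hE6def] at hE60
    field_simp
    ring
  rw [e, norm_div, norm_mul, norm_div, h6, h4, hE6n, div_one, div_one, one_mul]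
  refine (norm_sub_le_max₃ _ _).trans (max_le ((norm_sub_le_max₃ _ _).trans (max_le ?_ ?_)) ?_)
  · rw [norm_neg, norm_mul]
    calc ‖(240 : ℚ_[p])‖ * ‖tateS 3 q - q‖ ≤ 1 * ‖q‖ ^ 2 := by gcongr; exact_mod_cast hint 240
      _ = ‖q‖ ^ 2 := one_mul _
  · rw [norm_mul]
    calc ‖(504 : ℚ_[p])‖ * ‖tateS 5 q - q‖ ≤ 1 * ‖q‖ ^ 2 := by gcongr; exact_mod_cast hint 504
      _ = ‖q‖ ^ 2 := one_mul _
  · rw [norm_mul, norm_mul]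
    calc ‖(374976 : ℚ_[p])‖ * (‖q‖ * ‖tateS 5 q‖) ≤ 1 * (‖q‖ * ‖q‖) := by gcongr; exact_mod_cast hint 374976
      _ = ‖q‖ ^ 2 := by ring

end QSeries

/-! ### §14 Rational proxies for `κ_E = (C⁻²E₂(q) − b₂)/12` -/

section Kappa

variable {W : WeierstrassCurve ℚ}

/-- **`κ_E ≡ −κ₀' (mod q)` at `p ≥ 5`**: `‖κ_E + (b₂b₄ − 18b₆)/c₄‖_p ≤ ‖q‖_p` where
`κ_E = (C⁻²(1 − 24s₁(q)) − b₂)/12`: `12(κ_E + κ₀') = (C⁻² + c₆/c₄) − 24C⁻²s₁(q)` since `12(b₂b₄ − 18b₆) = c₆ + b₂c₄`;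
both terms are `O(q)` (`…SplitDigit`, `‖s₁‖ ≤ ‖q‖`), `‖12⁻¹‖_p = 1`. [cite: SilvermanATAEC1994, Thm. V.3.1 (b)] -/
theorem norm_kappaE_add_kappa₀_le_padic (hp5 : 5 ≤ p) [W.IsElliptic] [W.IsGloballyMinimal] (hW : Mult W p)
    {q : ℚ_[p]} (hq : ‖q‖ < 1) :
    ‖((uniformisationScaleSq W p q)⁻¹ * (1 - 24 * tateS 1 q) - (W.baseChange ℚ_[p]).b₂) / 12 +
        ((W.baseChange ℚ_[p]).b₂ * (W.baseChange ℚ_[p]).b₄ - 18 * (W.baseChange ℚ_[p]).b₆) /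
          (W.baseChange ℚ_[p]).c₄‖ ≤ ‖q‖ := by
  have hp2 : p ≠ 2 := by omega
  have hp3 : p ≠ 3 := by omega
  set C2 := uniformisationScaleSq W p q with hC2def
  set V := W.baseChange ℚ_[p] with hVdef
  set K := tateS 1 q with hKdef
  have hC : ‖C2‖ = 1 := norm_uniformisationScaleSq_eq_one hW hq
  have hCi : ‖C2⁻¹‖ = 1 := by rw [norm_inv, hC, inv_one]
  have hK : ‖K‖ ≤ ‖q‖ := norm_tateS_le hq.le
  have hc₄ : V.c₄ = (W.c₄ : ℚ_[p]) := (map_c₄ W (algebraMap ℚ ℚ_[p])).trans (eq_ratCast _ _)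
  have hc₆ : V.c₆ = (W.c₆ : ℚ_[p]) := (map_c₆ W (algebraMap ℚ ℚ_[p])).trans (eq_ratCast _ _)
  have h4 : ‖(W.c₄ : ℚ_[p])‖ = 1 := norm_c₄_eq_one_of_hasMultiplicativeReductionAtPrime hW
  have hc40 : V.c₄ ≠ 0 := by rw [hc₄]; exact norm_pos_iff.mp (by rw [h4]; exact one_pos)
  have hadd : ‖C2⁻¹ + V.c₆ / V.c₄‖ ≤ ‖q‖ := by
    rw [hc₄, hc₆]; exact norm_inv_uniformisationScaleSq_add_le hW hq
  have hcop2 : Nat.Coprime p 2 := (Nat.coprime_primes hp.out Nat.prime_two).mpr hp2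
  have hcop3 : Nat.Coprime p 3 := (Nat.coprime_primes hp.out Nat.prime_three).mpr hp3
  have h12i : ‖(12 : ℚ_[p])⁻¹‖ = 1 := by
    have h12 : Nat.Coprime p 12 := by
      rw [show (12 : ℕ) = 2 ^ 2 * 3 by norm_num]
      exact (Nat.Coprime.pow_right 2 hcop2).mul_right hcop3
    rw [norm_inv]; simpa using Padic.norm_natCast_eq_one_iff.mpr h12
  have h24 : ‖(24 : ℚ_[p])‖ ≤ 1 := by exact_mod_cast Padic.norm_int_le_one (p := p) 24
  have hc6def : V.c₆ = -V.b₂ ^ 3 + 36 * V.b₂ * V.b₄ - 216 * V.b₆ := rfl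
  have hc4def : V.c₄ = V.b₂ ^ 2 - 24 * V.b₄ := rfl
  have e : (C2⁻¹ * (1 - 24 * K) - V.b₂) / 12 + (V.b₂ * V.b₄ - 18 * V.b₆) / V.c₄ =
      ((C2⁻¹ + V.c₆ / V.c₄) - 24 * (C2⁻¹ * K)) * (12 : ℚ_[p])⁻¹ := by
    rw [hc6def]; rw [hc4def] at hc40 ⊢; field_simp; ring
  rw [e, norm_mul, h12i, mul_one]
  refine (norm_sub_le_max₃ _ _).trans (max_le hadd ?_)
  rw [norm_mul, norm_mul, hCi, one_mul]
  calc ‖(24 : ℚ_[p])‖ * ‖K‖ ≤ 1 * ‖q‖ := by gcongr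
    _ = ‖q‖ := one_mul _

/-- **`κ_E ≡ −κ₀' − 60(c₆/c₄)q (mod q²)` at `p ≥ 5`**: `‖κ_E + (b₂b₄ − 18b₆)/c₄ + 60(c₆/c₄)q‖_p ≤ ‖q‖_p²`
(`12·lhs = [C⁻² + (c₆/c₄)(1 + 744q)] − 24C⁻²(s₁ − q) − 24q(C⁻² + c₆/c₄)`, §13 and `…SplitDigit`).
[cite: SilvermanATAEC1994, Thm. V.3.1 (b)] -/
theorem norm_kappaE_add_kappa₀_add_linear_le_padic (hp5 : 5 ≤ p) [W.IsElliptic] [W.IsGloballyMinimal]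
    (hW : Mult W p) {q : ℚ_[p]} (hq : ‖q‖ < 1) :
    ‖((uniformisationScaleSq W p q)⁻¹ * (1 - 24 * tateS 1 q) - (W.baseChange ℚ_[p]).b₂) / 12 +
        ((W.baseChange ℚ_[p]).b₂ * (W.baseChange ℚ_[p]).b₄ - 18 * (W.baseChange ℚ_[p]).b₆) /
          (W.baseChange ℚ_[p]).c₄ +
        60 * ((W.baseChange ℚ_[p]).c₆ / (W.baseChange ℚ_[p]).c₄) * q‖ ≤ ‖q‖ ^ 2 := by
  have hp2 : p ≠ 2 := by omega
  have hp3 : p ≠ 3 := by omega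
  set C2 := uniformisationScaleSq W p q with hC2def
  set V := W.baseChange ℚ_[p] with hVdef
  set K := tateS 1 q with hKdef
  have hC : ‖C2‖ = 1 := norm_uniformisationScaleSq_eq_one hW hq
  have hCi : ‖C2⁻¹‖ = 1 := by rw [norm_inv, hC, inv_one]
  have hK : ‖K - q‖ ≤ ‖q‖ ^ 2 := norm_tateS_sub_self_le_padic 1 hq
  have hc₄ : V.c₄ = (W.c₄ : ℚ_[p]) := (map_c₄ W (algebraMap ℚ ℚ_[p])).trans (eq_ratCast _ _)
  have hc₆ : V.c₆ = (W.c₆ : ℚ_[p]) := (map_c₆ W (algebraMap ℚ ℚ_[p])).trans (eq_ratCast _ _)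
  have h4 : ‖(W.c₄ : ℚ_[p])‖ = 1 := norm_c₄_eq_one_of_hasMultiplicativeReductionAtPrime hW
  have hc40 : V.c₄ ≠ 0 := by rw [hc₄]; exact norm_pos_iff.mp (by rw [h4]; exact one_pos)
  have hadd : ‖C2⁻¹ + V.c₆ / V.c₄‖ ≤ ‖q‖ := by
    rw [hc₄, hc₆]; exact norm_inv_uniformisationScaleSq_add_le hW hq
  have hlin : ‖C2⁻¹ + V.c₆ / V.c₄ * (1 + 744 * q)‖ ≤ ‖q‖ ^ 2 := by
    rw [hc₄, hc₆]; exact norm_inv_uniformisationScaleSq_add_linear_le_padic hW hq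
  have hcop2 : Nat.Coprime p 2 := (Nat.coprime_primes hp.out Nat.prime_two).mpr hp2
  have hcop3 : Nat.Coprime p 3 := (Nat.coprime_primes hp.out Nat.prime_three).mpr hp3
  have h12i : ‖(12 : ℚ_[p])⁻¹‖ = 1 := by
    have h12 : Nat.Coprime p 12 := by
      rw [show (12 : ℕ) = 2 ^ 2 * 3 by norm_num]
      exact (Nat.Coprime.pow_right 2 hcop2).mul_right hcop3
    rw [norm_inv]; simpa using Padic.norm_natCast_eq_one_iff.mpr h12
  have h24 : ‖(24 : ℚ_[p])‖ ≤ 1 := by exact_mod_cast Padic.norm_int_le_one (p := p) 24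
  have hc6def : V.c₆ = -V.b₂ ^ 3 + 36 * V.b₂ * V.b₄ - 216 * V.b₆ := rfl
  have hc4def : V.c₄ = V.b₂ ^ 2 - 24 * V.b₄ := rfl
  have e : (C2⁻¹ * (1 - 24 * K) - V.b₂) / 12 + (V.b₂ * V.b₄ - 18 * V.b₆) / V.c₄ + 60 * (V.c₆ / V.c₄) * q =
      ((C2⁻¹ + V.c₆ / V.c₄ * (1 + 744 * q)) - 24 * (C2⁻¹ * (K - q)) - 24 * (q * (C2⁻¹ + V.c₆ / V.c₄))) *
        (12 : ℚ_[p])⁻¹ := by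
    rw [hc6def]; rw [hc4def] at hc40 ⊢; field_simp; ring
  rw [e, norm_mul, h12i, mul_one]
  refine (norm_sub_le_max₃ _ _).trans (max_le ((norm_sub_le_max₃ _ _).trans (max_le hlin ?_)) ?_)
  · rw [norm_mul, norm_mul, hCi, one_mul]
    calc ‖(24 : ℚ_[p])‖ * ‖K - q‖ ≤ 1 * ‖q‖ ^ 2 := by gcongr
      _ = ‖q‖ ^ 2 := one_mul _
  · rw [norm_mul, norm_mul]
    calc ‖(24 : ℚ_[p])‖ * (‖q‖ * ‖C2⁻¹ + V.c₆ / V.c₄‖) ≤ 1 * (‖q‖ * ‖q‖) := by gcongr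
      _ = ‖q‖ ^ 2 := by ring

/-- **The Tate-parameter form at `p ≥ 5`**: for `tateJ q = j(W)`, `‖κ_E + (b₂b₄ − 18b₆)/c₄ + 60(c₆/c₄)/j‖_p ≤ ‖q‖_p²`
(`‖1/j − q‖ ≤ ‖q‖²`, Silverman ATAEC Lemma V.5.1). With `1/j = Δ/c₄³`: for THE Tate parameter the quasi-period
constant is the RATIONAL `−[(b₂b₄ − 18b₆)c₄³ + 60c₆Δ]/c₄⁴` of the minimal model to `2ν` digits (`ν = v_p(Δ)`).
[cite: SilvermanATAEC1994, Thm. V.3.1 (b), Lemma V.5.1] -/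
theorem norm_kappaE_add_kappa₀_add_j_le_padic (hp5 : 5 ≤ p) [W.IsElliptic] [W.IsGloballyMinimal]
    (hW : Mult W p) {q : ℚ_[p]} (hq : ‖q‖ < 1) (hj : tateJ q = (W.j : ℚ_[p])) :
    ‖((uniformisationScaleSq W p q)⁻¹ * (1 - 24 * tateS 1 q) - (W.baseChange ℚ_[p]).b₂) / 12 +
        ((W.baseChange ℚ_[p]).b₂ * (W.baseChange ℚ_[p]).b₄ - 18 * (W.baseChange ℚ_[p]).b₆) /
          (W.baseChange ℚ_[p]).c₄ +
        60 * ((W.baseChange ℚ_[p]).c₆ / (W.baseChange ℚ_[p]).c₄) * ((W.j : ℚ_[p]))⁻¹‖ ≤ ‖q‖ ^ 2 := by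
  set V := W.baseChange ℚ_[p] with hVdef
  have h1 := norm_kappaE_add_kappa₀_add_linear_le_padic hp5 hW hq
  rw [← hVdef] at h1
  have hc₄ : V.c₄ = (W.c₄ : ℚ_[p]) := (map_c₄ W (algebraMap ℚ ℚ_[p])).trans (eq_ratCast _ _)
  have hc₆ : V.c₆ = (W.c₆ : ℚ_[p]) := (map_c₆ W (algebraMap ℚ ℚ_[p])).trans (eq_ratCast _ _)
  have h4 : ‖(W.c₄ : ℚ_[p])‖ = 1 := norm_c₄_eq_one_of_hasMultiplicativeReductionAtPrime hW
  have h6 : ‖(W.c₆ : ℚ_[p])‖ = 1 := norm_c₆_eq_one_of_mult hW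
  have h60 : ‖(60 : ℚ_[p])‖ ≤ 1 := by exact_mod_cast Padic.norm_int_le_one (p := p) 60
  have hjq : ‖((W.j : ℚ_[p]))⁻¹ - q‖ ≤ ‖q‖ ^ 2 := by
    rw [← hj, sq]; exact norm_inv_tateJ_sub_le hq
  have e : ((uniformisationScaleSq W p q)⁻¹ * (1 - 24 * tateS 1 q) - V.b₂) / 12 +
      (V.b₂ * V.b₄ - 18 * V.b₆) / V.c₄ + 60 * (V.c₆ / V.c₄) * ((W.j : ℚ_[p]))⁻¹ =
      (((uniformisationScaleSq W p q)⁻¹ * (1 - 24 * tateS 1 q) - V.b₂) / 12 +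
        (V.b₂ * V.b₄ - 18 * V.b₆) / V.c₄ + 60 * (V.c₆ / V.c₄) * q) +
        60 * (V.c₆ / V.c₄) * (((W.j : ℚ_[p]))⁻¹ - q) := by ring
  rw [e]
  refine (norm_add_le_max _ _).trans (max_le h1 ?_)
  rw [norm_mul, norm_mul, norm_div, hc₄, hc₆, h4, h6, div_one, mul_one]
  calc ‖(60 : ℚ_[p])‖ * ‖((W.j : ℚ_[p]))⁻¹ - q‖ ≤ 1 * ‖q‖ ^ 2 := by gcongr
    _ = ‖q‖ ^ 2 := one_mul _

end Kappa

/-! ### §15 The truncated Iwasawa logarithm -/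

section TruncatedLog

omit hp in
/-- `n + 1 ≤ 2ⁿ`. [folklore] -/
private theorem succ_le_two_pow' (n : ℕ) : n + 1 ≤ 2 ^ n := by
  induction n with
  | zero => norm_num
  | succ k ih => rw [pow_succ]; omega

/-- **The truncated logarithm**: for `‖u‖_p ≤ p⁻¹` and every `N`,
`‖log_p(1 + u) − Σ_{n<N} (−1)ⁿ uⁿ⁺¹/(n+1)‖_p ≤ (N+1)·‖u‖_p^{N+1}` (tail terms `uᵐ/m`, `m > N`, have norm
`≤ m‖u‖ᵐ ≤ (N+1)‖u‖^{N+1}` because `(j+1)p^{−j} ≤ 1`). [cite: Iwasawa1972PadicL, §4.4] -/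
theorem norm_padicLog_one_add_sub_sum_le_padic (N : ℕ) {u : ℚ_[p]} (hu : ‖u‖ ≤ (p : ℝ)⁻¹) :
    ‖padicLog p (1 + u) - ∑ n ∈ Finset.range N, (-1) ^ n * u ^ (n + 1) / ((n : ℚ_[p]) + 1)‖ ≤
      (N + 1) * ‖u‖ ^ (N + 1) := by
  have hp1 : (1 : ℝ) < p := by exact_mod_cast hp.out.one_lt
  have hp2 : (2 : ℝ) ≤ p := by exact_mod_cast hp.out.two_le
  have hp0 : (0 : ℝ) < p := by positivity
  have hu1 : ‖u‖ < 1 := hu.trans_lt (inv_lt_one_of_one_lt₀ hp1)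
  have hu0 : 0 ≤ ‖u‖ := norm_nonneg u
  have h1y : ‖1 - (1 + u)‖ < 1 := by rwa [sub_add_cancel_left, norm_neg]
  rw [padicLog_eq_padicLogSeries h1y]
  have ht : ‖-u‖ < 1 := by rwa [norm_neg]
  have hsum := summable_padicLogSeries_term (p := p) ht
  have hser : padicLogSeries p (1 + u) = ∑' n : ℕ, -((-u) ^ (n + 1)) / (n + 1 : ℚ_[p]) := by
    rw [padicLogSeries, sub_add_cancel_left]
  have hsplit := hsum.sum_add_tsum_nat_add N
  have hfin : ∑ n ∈ Finset.range N, -((-u) ^ (n + 1)) / ((n : ℚ_[p]) + 1) =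
      ∑ n ∈ Finset.range N, (-1) ^ n * u ^ (n + 1) / ((n : ℚ_[p]) + 1) := by
    refine Finset.sum_congr rfl fun n _ ↦ ?_
    rw [neg_pow, pow_succ (-1 : ℚ_[p]) n]; ring
  rw [hser, ← hsplit, hfin, add_sub_cancel_left]
  refine norm_tsum_le_of_forall_le_of_nonneg (by positivity) fun n ↦ ?_
  have hm0 : n + N + 1 ≠ 0 := by omega
  have e : -((-u) ^ (n + N + 1)) / ((((n + N : ℕ)) : ℚ_[p]) + 1) =
      -((-u) ^ (n + N + 1)) * (((n + N + 1 : ℕ) : ℚ_[p]))⁻¹ := by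
    push_cast; ring
  rw [e, norm_mul, norm_neg, norm_pow, norm_neg]
  have hinv := Literature.NumberTheory.EllipticCurves.norm_inv_natCast_le (p := p) hm0
  -- `(n+N+1) ‖u‖ⁿ ≤ N+1`: `(n+N+1) ≤ (n+1)(N+1)` and `(n+1)‖u‖ⁿ ≤ (n+1) p^{-n} ≤ 1`
  have hn1 : ((n : ℝ) + 1) * ‖u‖ ^ n ≤ 1 := by
    have h2n : ((n : ℝ) + 1) ≤ (2 : ℝ) ^ n := by exact_mod_cast succ_le_two_pow' n
    calc ((n : ℝ) + 1) * ‖u‖ ^ n ≤ (2 : ℝ) ^ n * ((p : ℝ)⁻¹) ^ n := by gcongr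
      _ = ((2 : ℝ) * (p : ℝ)⁻¹) ^ n := by rw [mul_pow]
      _ ≤ 1 ^ n := by
          apply pow_le_pow_left₀ (by positivity)
          rw [mul_inv_le_iff₀ hp0, one_mul]; exact hp2
      _ = 1 := one_pow _
  calc ‖u‖ ^ (n + N + 1) * ‖(((n + N + 1 : ℕ) : ℚ_[p]))⁻¹‖ ≤ ‖u‖ ^ (n + N + 1) * ((n + N + 1 : ℕ) : ℝ) := by
        gcongr
    _ ≤ ‖u‖ ^ (n + N + 1) * (((n : ℝ) + 1) * ((N : ℝ) + 1)) := by
        gcongr; push_cast; nlinarith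
    _ = (((n : ℝ) + 1) * ‖u‖ ^ n) * (((N : ℝ) + 1) * ‖u‖ ^ (N + 1)) := by ring
    _ ≤ 1 * (((N : ℝ) + 1) * ‖u‖ ^ (N + 1)) := by gcongr
    _ = (N + 1) * ‖u‖ ^ (N + 1) := one_mul _

/-- **`log_p` of an integer prime to `p`, truncated**: for `p ∤ a`, `A = a^{p−1} − 1` (so `p ∣ A`) and every `N`,
`‖log_p a − (p − 1)⁻¹·Σ_{n<N} (−1)ⁿAⁿ⁺¹/(n+1)‖_p ≤ (N+1)·‖A‖_p^{N+1}` (`log_p a = (p−1)⁻¹ log_p(a^{p−1})`, the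
Iwasawa normalisation, tree `padicLog_of_ne_zero`; `‖(p−1)⁻¹‖_p = 1`). [cite: Iwasawa1972PadicL, §4.4] -/
theorem norm_padicLog_intCast_sub_trunc_le_padic {a : ℤ} (ha : ¬ (p : ℤ) ∣ a) (N : ℕ) :
    ‖padicLog p (a : ℚ_[p]) - ((p : ℚ_[p]) - 1)⁻¹ *
        ∑ n ∈ Finset.range N, (-1) ^ n * (((a : ℚ_[p])) ^ (p - 1) - 1) ^ (n + 1) / ((n : ℚ_[p]) + 1)‖ ≤
      (N + 1) * ‖((a : ℚ_[p])) ^ (p - 1) - 1‖ ^ (N + 1) := by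
  have hpP : p.Prime := Fact.out
  have hp1 : (1 : ℝ) < p := by exact_mod_cast hpP.one_lt
  have ha1 : ‖(a : ℚ_[p])‖ = 1 := BinaryQuartic.norm_intCast_eq_one ha
  have ha0 : (a : ℚ_[p]) ≠ 0 := norm_pos_iff.mp (by rw [ha1]; exact one_pos)
  have hval : (a : ℚ_[p]).valuation = 0 := by
    have h := Padic.norm_eq_zpow_neg_valuation ha0
    rw [ha1] at h
    have h' : (p : ℝ) ^ (0 : ℤ) = (p : ℝ) ^ (-(a : ℚ_[p]).valuation) := by rw [zpow_zero]; exact h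
    have := zpow_right_injective₀ (by positivity) hp1.ne' h'
    omega
  set y : ℚ_[p] := ((a : ℚ_[p])) ^ (p - 1) with hy
  set A : ℚ_[p] := y - 1 with hA
  have hAlt : ‖1 - y‖ < 1 := by
    rw [norm_sub_rev]; exact norm_pow_sub_one_lt_one_of_norm_eq_one ha1
  have hAle : ‖A‖ ≤ (p : ℝ)⁻¹ := by
    have hAint : A = (((a ^ (p - 1) - 1 : ℤ)) : ℚ_[p]) := by rw [hA, hy]; push_cast; ring
    have hlt : ‖(((a ^ (p - 1) - 1 : ℤ)) : ℚ_[p])‖ < 1 := by rw [← hAint, hA, norm_sub_rev]; exact hAlt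
    have hdvd : (p : ℤ) ∣ a ^ (p - 1) - 1 := Padic.norm_intCast_lt_one_iff.mp hlt
    have h := (Padic.norm_int_le_pow_iff_dvd (a ^ (p - 1) - 1) 1).mpr (by simpa using hdvd)
    rw [hAint]; simpa using h
  have hlog : padicLog p (a : ℚ_[p]) = ((p : ℚ_[p]) - 1)⁻¹ * padicLog p (1 + A) := by
    rw [padicLog_of_ne_zero ha0, hval, neg_zero, zpow_zero, mul_one, ← hy,
      show (1 : ℚ_[p]) + A = y by rw [hA]; ring, padicLog_eq_padicLogSeries hAlt]
  have hc1 : ‖((p : ℚ_[p]) - 1)⁻¹‖ = 1 := by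
    rw [norm_inv]
    have : ‖(p : ℚ_[p]) - 1‖ = 1 := by
      rw [show (p : ℚ_[p]) - 1 = ((p - 1 : ℕ) : ℚ_[p]) by rw [Nat.cast_sub hpP.one_le, Nat.cast_one]]
      refine Padic.norm_natCast_eq_one_iff.mpr ?_
      exact (Nat.coprime_self_sub_right hpP.one_le).mpr (Nat.coprime_one_right _)
    rw [this, inv_one]
  rw [hlog, ← mul_sub, norm_mul, hc1, one_mul]
  exact norm_padicLog_one_add_sub_sum_le_padic N hAle

end TruncatedLog

end Summit.BirchSwinnertonDyer.Rank1Residual.X11b.RegMult.HeightLogNumerator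

end
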